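import Mathlib
import HarnessLib
import Literature.Geometry.Lorentzian.KerrSchild
import Literature.Geometry.Lorentzian.KerrWaveEnergy
import Literature.Geometry.Lorentzian.KerrConvergence
import Literature.Geometry.Lorentzian.KerrConvergenceProofs
import Literature.Geometry.Lorentzian.MultiCentreKerrSchild
import Literature.Geometry.Lorentzian.MultiCentreRadiationZone
import Literature.Geometry.Lorentzian.KerrSchildChartCovariance
import Summits.FinalStateConjecture.FinalStateConjecture.Theorems.LogTimeThreeAnnuliDyadicCaptureKerrSchildRigidity

/-!
# Route LogTimeThreeAnnuli · crux `DyadicCapture` · line `registered` — freezing assembly, part A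

Pointwise toolkit for `stub_freezingAssembly` (the analysis behind window freezing): for a chart
`Ψ : U → 𝓢` from a reference background `B` and two candidate reference fields `b₁, b₂` on `E4`,
the zero-extended deviations `Fᵢ = (Ψ^* g − bᵢ)·1_U` (`Spacetime.deviationExtend`) differ by
`(b₂ − b₁)·1_U` (`freezing_deviationExtend_sub`); where `Ψ` and the `bᵢ` are smooth the
`iteratedFDeriv`-triangle inequalities hold (`freezing_enorm_iteratedFDeriv_bilin_sub_le`,
`freezing_enorm_iteratedFDeriv_dev_le`) — smoothness is needed, the naive inequality fails for
non-differentiable `F`; for the boosted Kerr–Schild family `g_p = boostedKerrBilin Λ c p.1 p.2` the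
jets of `g_p − g_q` are invariant along the Killing orbit `x ↦ x + sΛe₀`
(`freezing_iteratedFDeriv_boosted_sub_add_smul`), the truncated slabs of the window backgrounds
`{boostedKerrBackground Λ c M' a' with bilin := g_p}` do not depend on `p` and are mapped into each
other by the orbit (`freezing_mem_slab_iff`, `freezing_add_smul_mem_slab`), and the rest-frame
radius of any `|α| ≤ A` is positive on the reference exterior once `α² ≤ a'² + max(r₊',0)²` fails to
be exceeded (`freezing_radius_pos_of_sq_le`). Pure bookkeeping over the tree's `KerrConvergence` /
`KerrSchildChartCovariance` / `MultiCentreRadiationZone`. Sources: Kerr–Schild 1965 §2 (stationarity);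
DHRT arXiv:2104.08222 §1 (the deviation norms).
-/

-- the `Summit.FinalStateConjecture.FinalStateConjecture.…` namespace repeats the summit = sub-problem
-- segment (D-0017 layout, CONVENTIONS §2); the duplicate is deliberate.
set_option linter.dupNamespace false

noncomputable section

namespace Summit.FinalStateConjecture.FinalStateConjecture.Theorems

open Literature.Geometry.Lorentzian
open scoped Topology Manifold ENNReal ContDiff
open Filter Set

/-! ### Two reference fields on one chart: the deviations differ by the fields -/

section TwoFields

variable {𝓢 : Spacetime.{0} 4} (B : ModelBackground) (Ψ : B.domain → 𝓢.carrier)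
  (b₁ b₂ : E4 → E4 →L[ℝ] E4 →L[ℝ] ℝ)

/-- On the domain, the deviations of one chart from two reference fields differ by the fields:
`(Ψ^*g − b₁) − (Ψ^*g − b₂) = b₂ − b₁` (DHRT arXiv:2104.08222, §1). [folklore] -/
theorem freezing_deviation_sub (x : B.domain) :
    𝓢.deviation {B with bilin := b₁} Ψ x - 𝓢.deviation {B with bilin := b₂} Ψ x = b₂ x.1 - b₁ x.1 := by
  ext v w
  simp only [sub_apply, Spacetime.deviation_apply]
  ring

/-- The zero-extended deviations from two reference fields differ by `(b₂ − b₁)·1_U`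
(DHRT arXiv:2104.08222, §1). [folklore] -/
theorem freezing_deviationExtend_sub (y : E4) :
    𝓢.deviationExtend {B with bilin := b₁} Ψ y - 𝓢.deviationExtend {B with bilin := b₂} Ψ y =
      (B.domain : Set E4).indicator (fun z ↦ b₂ z - b₁ z) y := by
  by_cases hy : y ∈ (B.domain : Set E4)
  · rw [Set.indicator_of_mem hy]
    have e1 := 𝓢.deviationExtend_coe {B with bilin := b₁} Ψ ⟨y, hy⟩
    have e2 := 𝓢.deviationExtend_coe {B with bilin := b₂} Ψ ⟨y, hy⟩
    have e3 := freezing_deviation_sub B Ψ b₁ b₂ ⟨y, hy⟩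
    simp only at e1 e2
    rw [e1, e2, e3]
  · rw [Set.indicator_of_notMem hy, 𝓢.deviationExtend_of_not_mem {B with bilin := b₁} Ψ hy,
      𝓢.deviationExtend_of_not_mem {B with bilin := b₂} Ψ hy]
    exact sub_zero (0 : E4 →L[ℝ] E4 →L[ℝ] ℝ)

/-- Near a point of the (open) domain the difference of the two zero-extended deviations IS the
difference of the fields (DHRT arXiv:2104.08222, §1). [folklore] -/
theorem freezing_deviationExtend_sub_eventuallyEq {y : E4} (hy : y ∈ B.domain) :
    (fun z ↦ 𝓢.deviationExtend {B with bilin := b₁} Ψ z - 𝓢.deviationExtend {B with bilin := b₂} Ψ z)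
      =ᶠ[𝓝 y] fun z ↦ b₂ z - b₁ z := by
  filter_upwards [B.domain.2.mem_nhds hy] with z hz
  rw [freezing_deviationExtend_sub]
  exact Set.indicator_of_mem (s := (B.domain : Set E4)) hz _

/-- The zero-extended deviation from a reference field smooth at a domain point is smooth there,
for a smooth chart (`contDiffAt_deviationExtend_model`; O'Neill 1983, Ch. 3, Lemma 3.35).
[cite: ONeill1983, Ch. 3, Lemma 3.35] -/
theorem freezing_contDiffAt_deviationExtend (hΨ : ContMDiff 𝓘(ℝ, E4) (𝓡 4) ∞ Ψ) {y : E4}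
    (hy : y ∈ B.domain) (hb : ContDiffAt ℝ ∞ b₁ y) :
    ContDiffAt ℝ ∞ (𝓢.deviationExtend {B with bilin := b₁} Ψ) y :=
  𝓢.contDiffAt_deviationExtend_model {B with bilin := b₁} hΨ ⟨y, hy⟩ hb

/-- **Triangle inequality for the jets of the difference of the fields**: at a domain point where
the chart and both fields are smooth, `‖Dᵐ(b₂ − b₁)‖ ≤ ‖Dᵐ(Ψ^*g − b₁)‖ + ‖Dᵐ(Ψ^*g − b₂)‖`
(`iteratedFDeriv_sub_apply`; smoothness is essential). [folklore] -/
theorem freezing_enorm_iteratedFDeriv_bilin_sub_le (hΨ : ContMDiff 𝓘(ℝ, E4) (𝓡 4) ∞ Ψ) {y : E4}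
    (hy : y ∈ B.domain) (hb₁ : ContDiffAt ℝ ∞ b₁ y) (hb₂ : ContDiffAt ℝ ∞ b₂ y) (m : ℕ) :
    ‖iteratedFDeriv ℝ m (fun z ↦ b₂ z - b₁ z) y‖ₑ ≤
      ‖iteratedFDeriv ℝ m (𝓢.deviationExtend {B with bilin := b₁} Ψ) y‖ₑ +
        ‖iteratedFDeriv ℝ m (𝓢.deviationExtend {B with bilin := b₂} Ψ) y‖ₑ := by
  have h1 := freezing_contDiffAt_deviationExtend B Ψ b₁ hΨ hy hb₁
  have h2 := freezing_contDiffAt_deviationExtend B Ψ b₂ hΨ hy hb₂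
  rw [← ((freezing_deviationExtend_sub_eventuallyEq B Ψ b₁ b₂ hy).iteratedFDeriv (𝕜 := ℝ) m).eq_of_nhds,
    ← Pi.sub_def, iteratedFDeriv_sub_apply (h1.of_le (mod_cast le_top)) (h2.of_le (mod_cast le_top))]
  exact enorm_sub_le

/-- **Triangle inequality for the jets of the second deviation**: at a domain point where the chart
and both fields are smooth, `‖Dᵐ(Ψ^*g − b₂)‖ ≤ ‖Dᵐ(Ψ^*g − b₁)‖ + ‖Dᵐ(b₁ − b₂)‖`. [folklore] -/
theorem freezing_enorm_iteratedFDeriv_dev_le (hΨ : ContMDiff 𝓘(ℝ, E4) (𝓡 4) ∞ Ψ) {y : E4}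
    (hy : y ∈ B.domain) (hb₁ : ContDiffAt ℝ ∞ b₁ y) (hb₂ : ContDiffAt ℝ ∞ b₂ y) (m : ℕ) :
    ‖iteratedFDeriv ℝ m (𝓢.deviationExtend {B with bilin := b₂} Ψ) y‖ₑ ≤
      ‖iteratedFDeriv ℝ m (𝓢.deviationExtend {B with bilin := b₁} Ψ) y‖ₑ +
        ‖iteratedFDeriv ℝ m (fun z ↦ b₁ z - b₂ z) y‖ₑ := by
  have h1 := freezing_contDiffAt_deviationExtend B Ψ b₁ hΨ hy hb₁
  have h2 := freezing_contDiffAt_deviationExtend B Ψ b₂ hΨ hy hb₂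
  have hsub : iteratedFDeriv ℝ m (fun z ↦ b₁ z - b₂ z) y =
      iteratedFDeriv ℝ m (𝓢.deviationExtend {B with bilin := b₂} Ψ) y -
        iteratedFDeriv ℝ m (𝓢.deviationExtend {B with bilin := b₁} Ψ) y := by
    rw [← ((freezing_deviationExtend_sub_eventuallyEq B Ψ b₂ b₁ hy).iteratedFDeriv (𝕜 := ℝ) m).eq_of_nhds,
      ← Pi.sub_def, iteratedFDeriv_sub_apply (h2.of_le (mod_cast le_top)) (h1.of_le (mod_cast le_top))]
  rw [hsub]
  calc ‖iteratedFDeriv ℝ m (𝓢.deviationExtend {B with bilin := b₂} Ψ) y‖ₑ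
      = ‖iteratedFDeriv ℝ m (𝓢.deviationExtend {B with bilin := b₁} Ψ) y +
          (iteratedFDeriv ℝ m (𝓢.deviationExtend {B with bilin := b₂} Ψ) y -
            iteratedFDeriv ℝ m (𝓢.deviationExtend {B with bilin := b₁} Ψ) y)‖ₑ := by
        rw [add_sub_cancel]
    _ ≤ _ := enorm_add_le _ _

/-- The `Cᵏ` sup norm bounds every jet of order `m ≤ k` at every point of the set
(`enorm_iteratedFDeriv_le_supCkENorm`, restated for the truncated deviation norm:
`‖Dᵐ(Ψ^*g − b)(y)‖ ≤ truncDeviationCk … k r τ` for `y` in the truncated slab). [folklore] -/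
theorem freezing_enorm_iteratedFDeriv_le_truncDeviationCk {k m : ℕ} (hm : m ≤ k) {r τ : ℝ}
    {y : E4} (hy : y ∈ Subtype.val '' ({B with bilin := b₁} : ModelBackground).truncTimeSlab r τ) :
    ‖iteratedFDeriv ℝ m (𝓢.deviationExtend {B with bilin := b₁} Ψ) y‖ₑ ≤
      𝓢.truncDeviationCk {B with bilin := b₁} Ψ k r τ :=
  enorm_iteratedFDeriv_le_supCkENorm hm hy _

end TwoFields

/-! ### The window backgrounds over a boosted Kerr exterior: slabs and the Killing orbit -/

section Boosted

variable (Λ : lorentzGroup) (c : E4) (M' a' : ℝ)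

/-- Membership in the truncated slab of a window background
`{boostedKerrBackground Λ c M' a' with bilin := b}` (it does not depend on `b`): the point lies in
the reference exterior, has rest-frame time `τ` and rest-frame reference radius `≤ r`. [folklore] -/
theorem freezing_mem_slab_iff (b : E4 → E4 →L[ℝ] E4 →L[ℝ] ℝ) (r τ : ℝ) (y : E4) :
    y ∈ Subtype.val '' ({boostedKerrBackground Λ c M' a' with bilin := b} : ModelBackground).truncTimeSlab r τ
      ↔ y ∈ (boostedKerrExterior Λ c M' a' : Set E4) ∧ poincareInv Λ c y 0 = τ ∧
          Kerr.radius a' (poincareInv Λ c y) ≤ r := by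
  constructor
  · rintro ⟨x, hx, rfl⟩
    exact ⟨x.2, hx.1, hx.2⟩
  · rintro ⟨hy, ht, hr⟩
    exact ⟨⟨y, hy⟩, ⟨ht, hr⟩, rfl⟩

/-- The Killing orbit `y ↦ y + sΛe₀` preserves the reference exterior (the rest-frame radius is
constant along it, `radius_add_smul`). [folklore] -/
theorem freezing_add_smul_mem_exterior {y : E4} (hy : y ∈ (boostedKerrExterior Λ c M' a' : Set E4))
    (s : ℝ) :
    y + s • (Λ : E4 ≃L[ℝ] E4) (EuclideanSpace.single (0 : Fin 4) (1 : ℝ)) ∈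
      (boostedKerrExterior Λ c M' a' : Set E4) := by
  have hr := KerrSchildChart.radius_add_smul Λ c M' a' y s
  simp only [boostedKerrBackground] at hr
  simp only [SetLike.mem_coe, mem_boostedKerrExterior, Kerr.mem_exterior] at hy ⊢
  rwa [hr]

/-- The Killing orbit maps the truncated slab at rest-frame time `τ` onto the one at time `τ + s`
(same radius bound; `time_add_smul`, `radius_add_smul`). [folklore] -/
theorem freezing_add_smul_mem_slab (b : E4 → E4 →L[ℝ] E4 →L[ℝ] ℝ) {r τ : ℝ} {y : E4}
    (hy : y ∈ Subtype.val ''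
      ({boostedKerrBackground Λ c M' a' with bilin := b} : ModelBackground).truncTimeSlab r τ)
    (s : ℝ) :
    y + s • (Λ : E4 ≃L[ℝ] E4) (EuclideanSpace.single (0 : Fin 4) (1 : ℝ)) ∈ Subtype.val ''
      ({boostedKerrBackground Λ c M' a' with bilin := b} : ModelBackground).truncTimeSlab r (τ + s) := by
  rw [freezing_mem_slab_iff] at hy ⊢
  obtain ⟨hU, ht, hr⟩ := hy
  refine ⟨freezing_add_smul_mem_exterior Λ c M' a' hU s, ?_, ?_⟩
  · have h := KerrSchildChart.time_add_smul Λ c M' a' y s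
    simp only [boostedKerrBackground] at h
    rw [h, ht]
  · have h := KerrSchildChart.radius_add_smul Λ c M' a' y s
    simp only [boostedKerrBackground] at h
    rw [h]
    exact hr

/-- **Stationarity of the jets of a difference of two members of the boosted Kerr–Schild family**
along the Killing orbit: `Dᵐ(g_p − g_q)(y + sΛe₀) = Dᵐ(g_p − g_q)(y)` (`boostedKerrBilin_add_smul`,
`iteratedFDeriv_comp_add_right`; Kerr–Schild 1965, §2). [cite: KerrSchild1965, §2] -/
theorem freezing_iteratedFDeriv_boosted_sub_add_smul (p q : ℝ × ℝ) (m : ℕ) (y : E4) (s : ℝ) :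
    iteratedFDeriv ℝ m (fun z ↦ boostedKerrBilin Λ c p.1 p.2 z - boostedKerrBilin Λ c q.1 q.2 z)
        (y + s • (Λ : E4 ≃L[ℝ] E4) (EuclideanSpace.single (0 : Fin 4) (1 : ℝ))) =
      iteratedFDeriv ℝ m (fun z ↦ boostedKerrBilin Λ c p.1 p.2 z - boostedKerrBilin Λ c q.1 q.2 z) y := by
  rw [← iteratedFDeriv_comp_add_right]
  congr 1
  funext z
  rw [KerrSchildChart.boostedKerrBilin_add_smul, KerrSchildChart.boostedKerrBilin_add_smul]

/-- A member `g_p` of the boosted family is smooth at every point whose rest-frame `p.2`-radius is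
positive (`contDiffAt_boostedKerrBilin`); restated with the `∞` exponent used by the deviation
toolkit. [cite: KerrSchild1965, §3] -/
theorem freezing_contDiffAt_boosted (p : ℝ × ℝ) {y : E4} (hy : 0 < Kerr.radius p.2 (poincareInv Λ c y)) :
    ContDiffAt ℝ ∞ (boostedKerrBilin Λ c p.1 p.2) y :=
  contDiffAt_boostedKerrBilin Λ c p.1 p.2 hy

/-- The difference of two members is smooth where both rest-frame radii are positive. [folklore] -/
theorem freezing_contDiffAt_boosted_sub (p q : ℝ × ℝ) {y : E4}
    (hp : 0 < Kerr.radius p.2 (poincareInv Λ c y)) (hq : 0 < Kerr.radius q.2 (poincareInv Λ c y)) :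
    ContDiffAt ℝ ∞ (fun z ↦ boostedKerrBilin Λ c p.1 p.2 z - boostedKerrBilin Λ c q.1 q.2 z) y :=
  (freezing_contDiffAt_boosted Λ c p hp).sub (freezing_contDiffAt_boosted Λ c q hq)

end Boosted

/-! ### Where the rest-frame radius of a window member can vanish -/

/-- On the equatorial plane `z = 0` the squared Kerr–Schild radius is `max (ρ² − a²) 0`
(Visser arXiv:0706.0622, (35): the inner root is `|ρ² − a²|`). [cite: arXiv07060622, (35)] -/
theorem freezing_radius_sq_of_three_eq_zero (a : ℝ) {x : E4} (h3 : x 3 = 0) :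
    Kerr.radius a x ^ 2 = max (E4.spatialNorm x ^ 2 - a ^ 2) 0 := by
  rw [Kerr.radius_sq, h3]
  have : (E4.spatialNorm x ^ 2 - a ^ 2) ^ 2 + 4 * a ^ 2 * (0 : ℝ) ^ 2 =
      (E4.spatialNorm x ^ 2 - a ^ 2) ^ 2 := by ring
  rw [this, Real.sqrt_sq_eq_abs]
  rcases le_or_gt 0 (E4.spatialNorm x ^ 2 - a ^ 2) with h | h
  · rw [abs_of_nonneg h, max_eq_left h]; ring
  · rw [abs_of_neg h, max_eq_right h.le]; ring

/-- A vanishing Kerr–Schild radius forces the point onto the closed disc `{z = 0, ρ² ≤ a²}`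
(Visser arXiv:0706.0622, (35)). [cite: arXiv07060622, (35)] -/
theorem freezing_three_eq_zero_of_radius_eq_zero (a : ℝ) {x : E4} (h : Kerr.radius a x = 0) :
    x 3 = 0 ∧ E4.spatialNorm x ^ 2 ≤ a ^ 2 := by
  have h3 : x 3 = 0 := by
    by_contra h3
    exact (kerrSchildRigidity_radius_pos a h3).ne' h
  refine ⟨h3, ?_⟩
  have hsq := freezing_radius_sq_of_three_eq_zero a h3
  rw [h] at hsq
  have : max (E4.spatialNorm x ^ 2 - a ^ 2) 0 = 0 := by simpa using hsq.symm
  have := le_of_max_le_left this.le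
  linarith

/-- **Window members with `α² ≤ a'² + max(r₊', 0)²` have positive rest-frame radius on the whole
reference exterior `{max(r₊',0) < r_{a'}}`**: a zero of `r_α` lies on the disc
`{z = 0, ρ² ≤ α²}`, where `r_{a'}² = max(ρ² − a'², 0) ≤ max(r₊', 0)²`. [folklore] -/
theorem freezing_radius_pos_of_sq_le {M' a' α : ℝ} {z : E4}
    (hα : α ^ 2 ≤ a' ^ 2 + max (Kerr.rPlus M' a') 0 ^ 2) (hz : z ∈ Kerr.exterior M' a') :
    0 < Kerr.radius α z := by
  rcases (Kerr.radius_nonneg α z).lt_or_eq with h | h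
  · exact h
  · exfalso
    obtain ⟨h3, hρ⟩ := freezing_three_eq_zero_of_radius_eq_zero α h.symm
    have hm : max (Kerr.rPlus M' a') 0 < Kerr.radius a' z := Kerr.mem_exterior.1 hz
    have hm0 : 0 ≤ max (Kerr.rPlus M' a') 0 := le_max_right _ _
    have hsq := freezing_radius_sq_of_three_eq_zero a' h3
    have hlt : max (Kerr.rPlus M' a') 0 ^ 2 < Kerr.radius a' z ^ 2 := by
      have := Kerr.radius_nonneg a' z
      nlinarith
    rw [hsq] at hlt
    have hle : max (E4.spatialNorm z ^ 2 - a' ^ 2) 0 ≤ max (Kerr.rPlus M' a') 0 ^ 2 :=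
      max_le (by linarith) (sq_nonneg _)
    linarith

/-- Boosted form of `freezing_radius_pos_of_sq_le`: on the reference boosted exterior every window
member with `α² ≤ a'² + max(r₊', 0)²` has positive rest-frame radius. [folklore] -/
theorem freezing_radius_pos_boosted (Λ : lorentzGroup) (c : E4) {M' a' α : ℝ} {y : E4}
    (hα : α ^ 2 ≤ a' ^ 2 + max (Kerr.rPlus M' a') 0 ^ 2)
    (hy : y ∈ (boostedKerrExterior Λ c M' a' : Set E4)) :
    0 < Kerr.radius α (poincareInv Λ c y) :=
  freezing_radius_pos_of_sq_le hα (mem_boostedKerrExterior.1 hy)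

/-- A lower bound for the Kerr–Schild radius by the spatial norm: `ρ² − α² ≤ r_α²`, so
`r_α ≥ R` as soon as `ρ² ≥ R² + α²` (`Kerr.spatialNorm_sq_sub_sq_le_radius_sq`). [folklore] -/
theorem freezing_le_radius_of_sq_le {α R : ℝ} (hR : 0 ≤ R) {z : E4}
    (h : R ^ 2 + α ^ 2 ≤ E4.spatialNorm z ^ 2) : R ≤ Kerr.radius α z := by
  have h1 := Kerr.spatialNorm_sq_sub_sq_le_radius_sq α z
  have h2 : R ^ 2 ≤ Kerr.radius α z ^ 2 := by linarith
  exact (pow_le_pow_iff_left₀ hR (Kerr.radius_nonneg α z) two_ne_zero).1 h2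

/-- **Part A, registered form** (`freezingA_radius_pos`, the name under which this helper file is
attached to the crux item): on the reference boosted exterior every window member with
`α² ≤ a'² + max(r₊', 0)²` has positive rest-frame radius. [folklore] -/
theorem freezingA_radius_pos : ∀ (Λ : lorentzGroup) (c : E4) (M' a' α : ℝ) (y : E4), α ^ 2 ≤ a' ^ 2 + max (Kerr.rPlus M' a') 0 ^ 2 → y ∈ (boostedKerrExterior Λ c M' a' : Set E4) → 0 < Kerr.radius α (poincareInv Λ c y) :=
  fun Λ c _ _ _ _ hα hy ↦ freezing_radius_pos_boosted Λ c hα hy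

end Summit.FinalStateConjecture.FinalStateConjecture.Theorems

end
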